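import Literature.NumberTheory.EllipticCurves.LocalTorsionDivisionPolynomialCertificateProofs
import HarnessLib

/-!
# The univariate division polynomials `preΨ'_n` evaluated by the elliptic-divisibility-sequence
# recursion (computable), and the `(t0)` binder `#E(ℚ_p)[p] = 1` at ANY prime `p ≥ 3` from one `decide`

Companion of `LocalTorsionDivisionPolynomialCertificateProofs` (cell `bsd-litref`, paper bcs25,
prover seat: `localTorsion_eq_zero_of_eval_preΨ'_ne_zero` / `natCard_localPTorsion_eq_one_of_eval_preΨ'_ne_zero`
— if `preΨ'_p(E₀)` has no zero in `ℤ/p^k` then `E(ℚ_p)[p] = 0`, Silverman *AEC* Ex. 3.7(f) +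
VII.3.1 — with the certificate made `decide`-able through CLOSED FORMS of `preΨ'_5`, `preΨ'_7`,
`preΨ'_11` written out in the `b`-invariants).  Beyond `p = 11` a closed form is not writable
(`preΨ'_13` has several hundred monomials), so this file (typer seat) supplies the certificate at
EVERY prime uniformly:

* §1 `PrePsiEval.eds b c d fuel n` — a fuel-structural (hence kernel-computable) twin of Mathlib's
  `preNormEDS' b c d n` (the auxiliary sequence of a normalised elliptic divisibility sequence,
  `Mathlib.NumberTheory.EllipticDivisibilitySequence`; Mathlib's definition recurses well-foundedly
  on `n ↦ n / 2` and does not reduce in the kernel), PROVED equal to it for `n ≤ fuel + 4`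
  (`PrePsiEval.eds_eq_preNormEDS'`, from Mathlib's `preNormEDS'_even` / `preNormEDS'_odd`);
* §2 `PrePsiEval.prePsi E n x = eds (Ψ₂Sq(x)²) (Ψ₃(x)) (preΨ₄(x)) n n` with the values
  `Ψ₂Sq(x) = 4x³ + b₂x² + 2b₄x + b₆`, `Ψ₃(x)`, `preΨ₄(x)` spelled out (AEC Ex. 3.7(a)), and
  **`PrePsiEval.eval_preΨ'`: `(E.preΨ' n).eval x = prePsi E x n` for every `n` over every commutative
  ring** (evaluation at `x` is a ring map, Mathlib `map_preNormEDS'`);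
* §3 the certificate theorems at any prime `p ≥ 3`: `forall_eval_preΨ'_ne_zero_of_certificate`
  (integer form: `p^k ∤ prePsi E₀ z p` for `0 ≤ z < p^k`) and `…_of_certificate_zmod` (modular form:
  `prePsi (E₀ ⊗ ℤ/p^k) z p ≠ 0`, small numbers), each ONE `decide` for explicit `E₀, p, k`, and through
  the prover seat's theorems **`localTorsion_eq_zero_of_certificate`** (`∀ P ∈ E(ℚ_p), p • P = O → P = O`)
  and **`natCard_localPTorsion_eq_one_of_certificate[_zmod]`** (`#{Q ∈ E(ℚ_p) : p • Q = O} = 1`, the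
  `(t0)` binder of the proof-covered Kim twins `Kim2022_…_of_localTorsionTrivial`; referee A R456.3 (C)
  exit «a (t0) row + a discharger at an anomalous p»).

Cost model (kernel): `p^k` evaluations (in practice `k = 2`), each a recursion tree of `O(p^{2.33})`
calls of `eds` on integers of a few thousand bits (integer form) or on `ℤ/p^k` (modular form); scratch
timings on the farm: `p = 5, 7, 11, 13` certificates of census keys decided in seconds each
(`set_option maxRecDepth 100000` from `p = 11` on).  DEFINITIONS WITH BODIES (computable evaluators)
+ THEOREMS; no named fact, no instance, nothing asserted about any curve; no `Summits/` file touched.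

## References
* J. H. Silverman, *The Arithmetic of Elliptic Curves*, 2nd ed., GTM 106 (2009), Exercise 3.7
  (division polynomials `ψ_n`; (a) the recursion, (f) `ψ_n` vanishes exactly on `E[n] ∖ O`),
  Prop. VII.3.1 with Thm. IV.6.1. [SilvermanAEC2009]
* M. Ward, *Memoir on elliptic divisibility sequences*, Amer. J. Math. 70 (1948) 31–74 (the
  recursion for `W_{2n+1}`, `W_{2n}`; Mathlib `preNormEDS'`; background only, not cited by a declaration).
* C.-H. Kim, Amer. J. Math. 148 (2026) = arXiv:2203.12159, Prop. 3.2 (PDF p. 15) (the locus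
  `E(ℚ_p)[p] ≠ 0`). [Kim2022StructureSelmer]
-/

open Polynomial

namespace Literature.NumberTheory.EllipticCurves

namespace PrePsiEval

/-! ### §1 The elliptic-divisibility-sequence recursion, fuel-structural -/

section EDS

variable {R : Type*} [CommRing R] (b c d : R)

/-- Fuel-structural twin of Mathlib's `preNormEDS' b c d : ℕ → R` (the auxiliary sequence of a
normalised elliptic divisibility sequence, values `0, 1, 1, c, d, …`): `eds b c d fuel n` follows the
same even/odd recursion, recursing on the first argument, so that it is COMPUTABLE by the kernel
(`decide`) where `preNormEDS'` (well-founded recursion) is not; `eds b c d fuel n = preNormEDS' b c d n`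
as soon as `n ≤ fuel + 4` (`eds_eq_preNormEDS'`). [cite: SilvermanAEC2009, Exercise 3.7 (initial values and the recursion for ψ_{2m+1}, ψ_{2m}; PDF pp. 97–98)] -/
def eds : ℕ → ℕ → R
  | _, 0 => 0
  | _, 1 => 1
  | _, 2 => 1
  | _, 3 => c
  | _, 4 => d
  | 0, _ + 5 => 0
  | fuel + 1, n + 5 =>
    if n % 2 = 0 then
      eds fuel (n / 2 + 4) * eds fuel (n / 2 + 2) ^ 3 * (if n / 2 % 2 = 0 then b else 1) -
        eds fuel (n / 2 + 1) * eds fuel (n / 2 + 3) ^ 3 * (if n / 2 % 2 = 0 then 1 else b)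
    else
      eds fuel (n / 2 + 2) ^ 2 * eds fuel (n / 2 + 3) * eds fuel (n / 2 + 5) -
        eds fuel (n / 2 + 1) * eds fuel (n / 2 + 3) * eds fuel (n / 2 + 4) ^ 2

/-- `eds … 0 = 0` (initial value). [cite: SilvermanAEC2009, Exercise 3.7 (initial values and the recursion for ψ_{2m+1}, ψ_{2m}; PDF pp. 97–98)] -/
@[simp] private theorem eds_zero (fuel : ℕ) : eds b c d fuel 0 = 0 := by cases fuel <;> rfl
/-- `eds … 1 = 1` (initial value). [cite: SilvermanAEC2009, Exercise 3.7 (initial values and the recursion for ψ_{2m+1}, ψ_{2m}; PDF pp. 97–98)] -/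
@[simp] private theorem eds_one (fuel : ℕ) : eds b c d fuel 1 = 1 := by cases fuel <;> rfl
/-- `eds … 2 = 1` (initial value). [cite: SilvermanAEC2009, Exercise 3.7 (initial values and the recursion for ψ_{2m+1}, ψ_{2m}; PDF pp. 97–98)] -/
@[simp] private theorem eds_two (fuel : ℕ) : eds b c d fuel 2 = 1 := by cases fuel <;> rfl
/-- `eds … 3 = c` (initial value). [cite: SilvermanAEC2009, Exercise 3.7 (initial values and the recursion for ψ_{2m+1}, ψ_{2m}; PDF pp. 97–98)] -/
@[simp] private theorem eds_three (fuel : ℕ) : eds b c d fuel 3 = c := by cases fuel <;> rfl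
/-- `eds … 4 = d` (initial value). [cite: SilvermanAEC2009, Exercise 3.7 (initial values and the recursion for ψ_{2m+1}, ψ_{2m}; PDF pp. 97–98)] -/
@[simp] private theorem eds_four (fuel : ℕ) : eds b c d fuel 4 = d := by cases fuel <;> rfl

/-- The odd-index step `W_{2m+5} = W_{m+4} W_{m+2}³ [b] − W_{m+1} W_{m+3}³ [b]` of the recursion
(Mathlib `preNormEDS'_odd`, the normalised form of AEC Ex. 3.7's `ψ_{2m+1} = ψ_{m+2}ψ_m³ − ψ_{m−1}ψ_{m+1}³`).
[cite: SilvermanAEC2009, Exercise 3.7 (initial values and the recursion for ψ_{2m+1}, ψ_{2m}; PDF pp. 97–98)] -/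
private theorem eds_succ_even (fuel m : ℕ) : eds b c d (fuel + 1) (2 * m + 5) =
    eds b c d fuel (m + 4) * eds b c d fuel (m + 2) ^ 3 * (if Even m then b else 1) -
      eds b c d fuel (m + 1) * eds b c d fuel (m + 3) ^ 3 * (if Even m then 1 else b) := by
  have h1 : (2 * m) % 2 = 0 := by omega
  have h2 : (2 * m) / 2 = m := by omega
  simp only [eds, h1, h2, ↓reduceIte, Nat.even_iff]

/-- The even-index step `W_{2m+6} = W_{m+2}² W_{m+3} W_{m+5} − W_{m+1} W_{m+3} W_{m+4}²` of the
recursion (Mathlib `preNormEDS'_even`, the normalised form of AEC Ex. 3.7's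
`ψ₂ψ_{2m} = ψ_{m−1}²ψ_mψ_{m+2} − ψ_{m−2}ψ_mψ_{m+1}²`). [cite: SilvermanAEC2009, Exercise 3.7 (initial values and the recursion for ψ_{2m+1}, ψ_{2m}; PDF pp. 97–98)] -/
private theorem eds_succ_odd (fuel m : ℕ) : eds b c d (fuel + 1) (2 * m + 1 + 5) =
    eds b c d fuel (m + 2) ^ 2 * eds b c d fuel (m + 3) * eds b c d fuel (m + 5) -
      eds b c d fuel (m + 1) * eds b c d fuel (m + 3) * eds b c d fuel (m + 4) ^ 2 := by
  have h1 : (2 * m + 1) % 2 = 1 := by omega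
  have h2 : (2 * m + 1) / 2 = m := by omega
  simp only [eds, h1, h2, one_ne_zero, ↓reduceIte]

/-- **`eds` computes Mathlib's `preNormEDS'`** (the division-polynomial / elliptic-divisibility-sequence
recursion of AEC Exercise 3.7, in Mathlib's normalised univariate form; AEC Exercise 3.34(d): `ψ_n(P)` is an
elliptic divisibility sequence), whenever `n ≤ fuel + 4`. [cite: SilvermanAEC2009, Exercise 3.7 (initial values and the recursion for ψ_{2m+1}, ψ_{2m}; PDF pp. 97–98)]
[cite: SilvermanAEC2009, Exercise 3.34(d) (PDF p. 108)] -/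
theorem eds_eq_preNormEDS' : ∀ (fuel n : ℕ), n ≤ fuel + 4 → eds b c d fuel n = preNormEDS' b c d n
  | 0, n, hn => by
    interval_cases n <;> simp
  | fuel + 1, n, hn => by
    by_cases h4 : n ≤ 4
    · interval_cases n <;> simp
    · obtain ⟨k, rfl⟩ : ∃ k, n = k + 5 := ⟨n - 5, by omega⟩
      obtain ⟨m, rfl | rfl⟩ := Nat.even_or_odd' k
      · rw [eds_succ_even, show 2 * m + 5 = 2 * (m + 2) + 1 by ring, preNormEDS'_odd,
          eds_eq_preNormEDS' fuel (m + 4) (by omega), eds_eq_preNormEDS' fuel (m + 2) (by omega),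
          eds_eq_preNormEDS' fuel (m + 1) (by omega), eds_eq_preNormEDS' fuel (m + 3) (by omega)]
      · rw [eds_succ_odd, show 2 * m + 1 + 5 = 2 * (m + 3) by ring, preNormEDS'_even,
          eds_eq_preNormEDS' fuel (m + 2) (by omega), eds_eq_preNormEDS' fuel (m + 3) (by omega),
          eds_eq_preNormEDS' fuel (m + 5) (by omega), eds_eq_preNormEDS' fuel (m + 1) (by omega),
          eds_eq_preNormEDS' fuel (m + 4) (by omega)]

end EDS

/-! ### §2 `preΨ'_n(x)` computed on values -/

section Curve

variable {R : Type*} [CommRing R] (W : WeierstrassCurve R) (x : R)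

/-- The value `Ψ₂Sq(x) = 4x³ + b₂x² + 2b₄x + b₆`. [cite: SilvermanAEC2009, Exercise 3.7(a)] -/
def psi2Sq : R := 4 * x ^ 3 + W.b₂ * x ^ 2 + 2 * W.b₄ * x + W.b₆

/-- The value `Ψ₃(x) = 3x⁴ + b₂x³ + 3b₄x² + 3b₆x + b₈`. [cite: SilvermanAEC2009, Exercise 3.7(a)] -/
def psi3 : R := 3 * x ^ 4 + W.b₂ * x ^ 3 + 3 * W.b₄ * x ^ 2 + 3 * W.b₆ * x + W.b₈

/-- The value `preΨ₄(x) = 2x⁶ + b₂x⁵ + 5b₄x⁴ + 10b₆x³ + 10b₈x² + (b₂b₈ − b₄b₆)x + (b₄b₈ − b₆²)`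
(`ψ₄ = preΨ₄ · ψ₂`). [cite: SilvermanAEC2009, Exercise 3.7(a)] -/
def prePsi4 : R := 2 * x ^ 6 + W.b₂ * x ^ 5 + 5 * W.b₄ * x ^ 4 + 10 * W.b₆ * x ^ 3 +
  10 * W.b₈ * x ^ 2 + (W.b₂ * W.b₈ - W.b₄ * W.b₆) * x + (W.b₄ * W.b₈ - W.b₆ ^ 2)

/-- **Computable evaluation of the univariate division polynomial `preΨ'_n` at `x`** by the
elliptic-divisibility-sequence recursion (`b = Ψ₂Sq(x)²`, `c = Ψ₃(x)`, `d = preΨ₄(x)`).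
[cite: SilvermanAEC2009, Exercise 3.7(a)] -/
def prePsi (n : ℕ) : R := eds (psi2Sq W x ^ 2) (psi3 W x) (prePsi4 W x) n n

/-- `Ψ₂Sq(x) = 4x³ + b₂x² + 2b₄x + b₆`. [cite: SilvermanAEC2009, Exercise 3.7(a)] -/
theorem eval_Ψ₂Sq : W.Ψ₂Sq.eval x = psi2Sq W x := by
  simp only [WeierstrassCurve.Ψ₂Sq, eval_add, eval_mul, eval_pow, eval_C, eval_X, psi2Sq]

/-- `Ψ₃(x) = 3x⁴ + b₂x³ + 3b₄x² + 3b₆x + b₈`. [cite: SilvermanAEC2009, Exercise 3.7(a)] -/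
theorem eval_Ψ₃ : W.Ψ₃.eval x = psi3 W x := by
  simp only [WeierstrassCurve.Ψ₃, eval_add, eval_mul, eval_pow, eval_C, eval_X, eval_ofNat, psi3]

/-- `preΨ₄(x) = 2x⁶ + b₂x⁵ + 5b₄x⁴ + 10b₆x³ + 10b₈x² + (b₂b₈ − b₄b₆)x + (b₄b₈ − b₆²)`.
[cite: SilvermanAEC2009, Exercise 3.7(a)] -/
theorem eval_preΨ₄ : W.preΨ₄.eval x = prePsi4 W x := by
  simp only [WeierstrassCurve.preΨ₄, eval_add, eval_mul, eval_pow, eval_C, eval_X, eval_ofNat,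
    prePsi4]

/-- **`preΨ'_n(x)` is computed by `prePsi`** (for every `n` and every commutative ring):
evaluation at `x` is a ring map, so it carries Mathlib's recursion for `preΨ'` (`map_preNormEDS'`)
to the recursion `eds` on values. [cite: SilvermanAEC2009, Exercise 3.7(a)] -/
theorem eval_preΨ' (n : ℕ) : (W.preΨ' n).eval x = prePsi W x n := by
  rw [WeierstrassCurve.preΨ', ← coe_evalRingHom, map_preNormEDS', coe_evalRingHom, eval_pow,
    eval_Ψ₂Sq, eval_Ψ₃, eval_preΨ₄, prePsi, eds_eq_preNormEDS' _ _ _ n n (by omega)]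

end Curve

end PrePsiEval

/-! ### §3 The `(t0)` binder at ANY prime `p ≥ 3` from a `decide`-able certificate -/

section Certificate

open scoped Classical

variable (W₀ : WeierstrassCurve ℤ) (p : ℕ) [Fact p.Prime]

/-- From the integer certificate «`p^k ∤ preΨ'_p(E₀)(z)` for all `0 ≤ z < p^k`» (computed by
`PrePsiEval.prePsi`) to «`preΨ'_p(E₀)` has no zero in `ℤ/p^k`». [cite: SilvermanAEC2009, Exercise 3.7(a)] -/
theorem forall_eval_preΨ'_ne_zero_of_certificate (k : ℕ)
    (hcert : ∀ z : ℕ, z < p ^ k → ¬ ((p ^ k : ℕ) : ℤ) ∣ PrePsiEval.prePsi W₀ (z : ℤ) p) :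
    ∀ z : ZMod (p ^ k), ((W₀.preΨ' p).map (Int.castRingHom (ZMod (p ^ k)))).eval z ≠ 0 := by
  intro zz hzz
  haveI : NeZero (p ^ k) := ⟨pow_ne_zero _ (Fact.out : p.Prime).ne_zero⟩
  have hz : ((zz.val : ℤ) : ZMod (p ^ k)) = zz := by
    rw [Int.cast_natCast, ZMod.natCast_zmod_val]
  rw [← hz, Polynomial.eval_intCast_map, Int.coe_castRingHom, PrePsiEval.eval_preΨ',
    ZMod.intCast_zmod_eq_zero_iff_dvd] at hzz
  exact hcert zz.val (ZMod.val_lt zz) hzz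


/-- The same from the MODULAR certificate «`preΨ'_p(E₀ ⊗ ℤ/p^k)(z) ≠ 0` for all `0 ≤ z < p^k`», the
recursion being run in `ℤ/p^k` (small numbers; `PrePsiEval.prePsi` of the reduced equation).
[cite: SilvermanAEC2009, Exercise 3.7(a)] -/
theorem forall_eval_preΨ'_ne_zero_of_certificate_zmod (k : ℕ)
    (hcert : ∀ z : ℕ, z < p ^ k →
      PrePsiEval.prePsi (W₀.map (Int.castRingHom (ZMod (p ^ k)))) (z : ZMod (p ^ k)) p ≠ 0) :
    ∀ z : ZMod (p ^ k), ((W₀.preΨ' p).map (Int.castRingHom (ZMod (p ^ k)))).eval z ≠ 0 := by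
  intro zz hzz
  haveI : NeZero (p ^ k) := ⟨pow_ne_zero _ (Fact.out : p.Prime).ne_zero⟩
  rw [← WeierstrassCurve.map_preΨ', PrePsiEval.eval_preΨ', ← ZMod.natCast_zmod_val zz] at hzz
  exact hcert zz.val (ZMod.val_lt zz) hzz

/-- **`E(ℚ_p)[p] = 0` at ANY prime `p ≥ 3` from a `decide`-able integer certificate.** `E₀/ℤ` an
integral Weierstrass equation, `V = E₀ ⊗ ℚ_p` elliptic, `k : ℕ`; if `p^k ∤ preΨ'_p(E₀)(z)` for every
`0 ≤ z < p^k` — `preΨ'_p(E₀)(z) ∈ ℤ` computed by the elliptic-divisibility-sequence recursion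
`PrePsiEval.prePsi`, so that the hypothesis is ONE `decide` for explicit `E₀, p, k` — then every
`P ∈ V(ℚ_p)` with `p • P = O` is `O` (the tree's `localTorsion_eq_zero_of_eval_preΨ'_ne_zero`, AEC
Ex. 3.7(f) + VII.3.1). [cite: SilvermanAEC2009, Exercise 3.7(f) and VII.3 Prop. 3.1 (with IV.6 Thm. 6.1)]
[cite: Kim2022StructureSelmer, Prop. 3.2 (PDF p. 15)] -/
theorem localTorsion_eq_zero_of_certificate (hp3 : 3 ≤ p) (k : ℕ)
    (hcert : ∀ z : ℕ, z < p ^ k → ¬ ((p ^ k : ℕ) : ℤ) ∣ PrePsiEval.prePsi W₀ (z : ℤ) p)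
    (V : WeierstrassCurve ℚ_[p]) [V.IsElliptic] (hV : W₀.map (Int.castRingHom ℚ_[p]) = V)
    (P : V.toAffine.Point) (hP : (p : ℤ) • P = 0) : P = 0 :=
  localTorsion_eq_zero_of_eval_preΨ'_ne_zero W₀ p hp3 k
    (forall_eval_preΨ'_ne_zero_of_certificate W₀ p k hcert) V hV P hP

/-- **The `(t0)` binder `#E(ℚ_p)[p] = 1` at ANY prime `p ≥ 3` from a `decide`-able integer
certificate**: `E/ℚ` elliptic with an integral equation `E₀/ℤ` (`E₀ ⊗ ℚ = E`), `k : ℕ`, and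
`p^k ∤ preΨ'_p(E₀)(z)` for all `0 ≤ z < p^k` (`PrePsiEval.prePsi`; in practice `k = 2`, `p²`
evaluations) ⟹ `#{Q ∈ E(ℚ_p) : p • Q = O} = 1` — the binder of the proof-covered Kim twins
`Kim2022_…_of_localTorsionTrivial`, at every prime uniformly (the tree's
`natCard_localPTorsion_eq_one_of_certificate_five/_seven/_eleven` are the closed-form instances
`p = 5, 7, 11`). [cite: SilvermanAEC2009, Exercise 3.7(f) and VII.3 Prop. 3.1 (with IV.6 Thm. 6.1)]
[cite: Kim2022StructureSelmer, Prop. 3.2 (PDF p. 15)] -/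
theorem natCard_localPTorsion_eq_one_of_certificate (hp3 : 3 ≤ p) (W : WeierstrassCurve ℚ)
    [W.IsElliptic] (hW : W₀.map (Int.castRingHom ℚ) = W) (k : ℕ)
    (hcert : ∀ z : ℕ, z < p ^ k → ¬ ((p ^ k : ℕ) : ℤ) ∣ PrePsiEval.prePsi W₀ (z : ℤ) p) :
    Nat.card {Q : (W.baseChange ℚ_[p]).toAffine.Point // (p : ℕ) • Q = 0} = 1 :=
  natCard_localPTorsion_eq_one_of_eval_preΨ'_ne_zero W₀ p W hW hp3 k
    (forall_eval_preΨ'_ne_zero_of_certificate W₀ p k hcert)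

/-- **The `(t0)` binder `#E(ℚ_p)[p] = 1` at ANY prime `p ≥ 3` from the MODULAR certificate**
(`preΨ'_p` of the reduced equation `E₀ ⊗ ℤ/p^k` nowhere zero on `ℤ/p^k`, by `PrePsiEval.prePsi` in
`ℤ/p^k` — the cheap form for larger `p`). [cite: SilvermanAEC2009, Exercise 3.7(f) and VII.3 Prop. 3.1 (with IV.6 Thm. 6.1)]
[cite: Kim2022StructureSelmer, Prop. 3.2 (PDF p. 15)] -/
theorem natCard_localPTorsion_eq_one_of_certificate_zmod (hp3 : 3 ≤ p) (W : WeierstrassCurve ℚ)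
    [W.IsElliptic] (hW : W₀.map (Int.castRingHom ℚ) = W) (k : ℕ)
    (hcert : ∀ z : ℕ, z < p ^ k →
      PrePsiEval.prePsi (W₀.map (Int.castRingHom (ZMod (p ^ k)))) (z : ZMod (p ^ k)) p ≠ 0) :
    Nat.card {Q : (W.baseChange ℚ_[p]).toAffine.Point // (p : ℕ) • Q = 0} = 1 :=
  natCard_localPTorsion_eq_one_of_eval_preΨ'_ne_zero W₀ p W hW hp3 k
    (forall_eval_preΨ'_ne_zero_of_certificate_zmod W₀ p k hcert)

end Certificate


end Literature.NumberTheory.EllipticCurves
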